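import Summits.PneNP.PneNP.Theorems.ChebyshevTracialDesignVirtualBimode
import Summits.PneNP.PneNP.Theorems.ChebyshevTracialDesignTracialProfilePolynomial
import HarnessLib

/-!
# Cell pnp-psdrank, route `ChebyshevTracialDesign`: the VIRTUAL VALUE of a MATRIX-VALUED strategy in bi-mode form — the averaged Grigoriev
# pseudo-expectation of the entrywise low part is the sum of the Hilbert–Schmidt tight modes, re-weighted layer by layer by `R_κ = 1 + ρ_{2κ}`

Harmonic backbone of the crux `TracialDecayExp20` (stmt-PneNP-19878), brick 45b (prover g10; MEMO-12 §2(d) "the mode budget for psd" as a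
kernel identity). Brick 20 (`…TracialProfilePolynomial.tracial_value_truncation_explicit`, `tracialValueLEAt_of_virtualNonneg`) reduces the crux
at every dimension `r` to the sign of the VIRTUAL VALUE `(1/|PM|)·Σ_M Σ_{|A|≤D} tr(Q_A Y_M)·knapsackMoment(|M|, t/2, |M[A]|)` of the entrywise
low part `X^{≤D}_U = Σ_{A ⊆ U} Q_A` (`Q_A[a,b] = q^{ab}_A`, `q^{ab} = Σ_j (t−j)!·[j ≤ D]·p^{ab}_j`, `p^{ab}_j` the harmonic layers of the entry
`U ↦ X_U[a,b]`). Brick 45 (`…VirtualBimode.virtual_weighted_mul_eq`) is LINEAR in the test function and the weights, so summing it over the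
entry pairs `(a,b)` with weights `y^{ba}(M) = Y_M[b,a]` gives (`virtual_psd_mul_eq`):
`(Σ_M Σ_{|A|≤D} tr(Q_A Y_M)·K_M(A)) · N₁ = Σ_{κ ≤ D/2} R_κ · Σ_{(a,b)} T_{2κ}(p^{ab}, y^{ba})`,
`T_{2κ}(p^{ab}, y^{ba}) = Σ_M Y_M[b,a] Σ_{|U|=t} ((Wᵀ)^{t−2κ} p^{ab}_{2κ})(U)·1[cc(U,M) = 1]` the Hilbert–Schmidt tight layer correlations
(brick 36 `…GlobalMisalignment` used their `κ = 0` instance). So for psd strategies too the virtual value is 'overlap + re-weighted tight modes':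
the `κ = 0` term is `N₁·t!·Σ_{(a,b)} p^{ab}_0(∅)·Σ_M Y_M[b,a]` (`layerCorr_zero_weighted`), i.e. `N₁·|PM|·tr(X̄ Ȳ)` with `X̄` the slice mean
of `X` — the overlap that tightness forces to be small (brick 36 `avg_overlap_le`) and which, unlike `μν` at `r = 1`, is decoupled from the
trace densities (MEMO-12 §2(d)): the ONE place where the r = 1 argument (brick 46: 'the constant mode wins') does not lift to psd.
[cite: Grigoriev2001, Lemma 1.4 (PDF p. 8)] [cite: Rothvoss2017, §2 (PDF p. 6)] [cite: GriblingDelaatLaurent2019, §5]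
Stature: support/instrument (no defs). WHAT THIS IS NOT: not virtual nonnegativity for psd strategies, nothing on psd rank, no P-vs-NP content.
Supports stmt-PneNP-19878.
-/

set_option linter.dupNamespace false -- `Summit.PneNP.PneNP.…`: summit = sub-problem (D-0017)

noncomputable section

namespace Summit.PneNP.PneNP.Theorems.ChebyshevTracialDesignVirtualBimodePsd

open Finset Matrix Literature.Barriers.PneNP Literature.Computability.Complexity Literature.Combinatorics.Optimization
open Literature.Combinatorics.AssociationSchemes Literature.Combinatorics.AssociationSchemes.JohnsonHarmonics
open Literature.Combinatorics.AssociationSchemes.JohnsonSpectrum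
open Summit.PneNP.PneNP.Theorems.ChebyshevTracialDesignTracialProfilePolynomial (trace_mul_eq_sum_pairs)
open Summit.PneNP.PneNP.Theorems.ChebyshevTracialDesignVirtualBimode

variable {n : ℕ}

/-- The trace of `(of Q_A) * Y` as a sum over entry pairs. [folklore] -/
theorem trace_of_mul_eq {r : ℕ} (Q : Fin r → Fin r → ℝ) (Y : Matrix (Fin r) (Fin r) ℝ) :
    (Matrix.of (fun a b : Fin r => Q a b) * Y).trace = ∑ ab : Fin r × Fin r, Q ab.1 ab.2 * Y ab.2 ab.1 :=
  trace_mul_eq_sum_pairs _ _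

/-- **The virtual value of a matrix-valued strategy through the Hilbert–Schmidt tight modes.** For `n` even, `t = 2c'+1`, `2t ≤ n`, `D ≤ 2c'`,
entrywise harmonic layers `p^{ab}_j` and ANY matrix weights `Y`:
`(Σ_M Σ_{|A|≤D} tr(Q_A Y_M)·knapsackMoment(|M|, t/2, x_M(A)))·N₁ = Σ_{κ≤D/2} R_κ · Σ_{(a,b)} T_{2κ}(p^{ab}, y^{ba})`, `y^{ba}(M) = Y_M[b,a]`.
[cite: Grigoriev2001, Lemma 1.4 (PDF p. 8)] [cite: Rothvoss2017, §2 (PDF p. 6)] [cite: GriblingDelaatLaurent2019, §5] -/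
theorem virtual_psd_mul_eq {c' D r : ℕ} (hn : Even n) (ht : 2 * (2 * c' + 1) ≤ n) (hD : D ≤ 2 * c')
    (p : Fin r × Fin r → ℕ → Finset (Fin n) → ℝ) (hp : ∀ ab j, IsHarmonic j (p ab j)) (Y : PMatch n → Matrix (Fin r) (Fin r) ℝ) :
    (∑ M : PMatch n, ∑ A : {A : Finset (Fin n) // A.card ≤ D},
        (Matrix.of (fun a b : Fin r =>
          (∑ j ∈ range (2 * c' + 1 + 1), ((2 * c' + 1 - j).factorial : ℝ) • (if D < j then 0 else p (a, b) j)) A.1) * Y M).trace *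
          knapsackMoment M.1.card (((2 * c' + 1 : ℕ) : ℝ) / 2) (M.1.filter fun e => ∃ a ∈ A.1, a ∈ e).card) *
        ((((n / 2).choose (1 + c') * (1 + c').choose c' * 2 ^ 1 : ℕ) : ℝ)) =
      ∑ κ ∈ range (D / 2 + 1),
        (∏ i ∈ range κ, (((2 * c' + 1 : ℝ) - 2 * i) * ((n : ℝ) - 2 * c' - 1 - 2 * i) /
            (((2 * c' : ℝ) - 2 * i) * ((n : ℝ) - 2 * c' - 2 - 2 * i)))) *
          ∑ ab : Fin r × Fin r, ∑ M : PMatch n, Y M ab.2 ab.1 * ∑ U ∈ univ.powersetCard (2 * c' + 1),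
            (up^[2 * c' + 1 - 2 * κ] (p ab (2 * κ))) U * (if (U.filter fun x => M.2.partner x ∉ U).card = 1 then (1 : ℝ) else 0) := by
  -- expand the traces entrywise and swap the sums so that each entry pair is a weighted rectangle
  have hexp : ∑ M : PMatch n, ∑ A : {A : Finset (Fin n) // A.card ≤ D},
      (Matrix.of (fun a b : Fin r =>
        (∑ j ∈ range (2 * c' + 1 + 1), ((2 * c' + 1 - j).factorial : ℝ) • (if D < j then 0 else p (a, b) j)) A.1) * Y M).trace *
        knapsackMoment M.1.card (((2 * c' + 1 : ℕ) : ℝ) / 2) (M.1.filter fun e => ∃ a ∈ A.1, a ∈ e).card =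
      ∑ ab : Fin r × Fin r, ∑ M : PMatch n, Y M ab.2 ab.1 * ∑ A : {A : Finset (Fin n) // A.card ≤ D},
        (∑ j ∈ range (2 * c' + 1 + 1), ((2 * c' + 1 - j).factorial : ℝ) • (if D < j then 0 else p ab j)) A.1 *
          knapsackMoment M.1.card (((2 * c' + 1 : ℕ) : ℝ) / 2) (M.1.filter fun e => ∃ a ∈ A.1, a ∈ e).card := by
    have h1 : ∀ (M : PMatch n) (A : {A : Finset (Fin n) // A.card ≤ D}),
        (Matrix.of (fun a b : Fin r =>
          (∑ j ∈ range (2 * c' + 1 + 1), ((2 * c' + 1 - j).factorial : ℝ) • (if D < j then 0 else p (a, b) j)) A.1) * Y M).trace *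
          knapsackMoment M.1.card (((2 * c' + 1 : ℕ) : ℝ) / 2) (M.1.filter fun e => ∃ a ∈ A.1, a ∈ e).card =
        ∑ ab : Fin r × Fin r, Y M ab.2 ab.1 *
          ((∑ j ∈ range (2 * c' + 1 + 1), ((2 * c' + 1 - j).factorial : ℝ) • (if D < j then 0 else p ab j)) A.1 *
            knapsackMoment M.1.card (((2 * c' + 1 : ℕ) : ℝ) / 2) (M.1.filter fun e => ∃ a ∈ A.1, a ∈ e).card) := by
      intro M A
      rw [trace_of_mul_eq, sum_mul]
      exact sum_congr rfl fun ab _ => by ring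
    calc _ = ∑ M : PMatch n, ∑ A : {A : Finset (Fin n) // A.card ≤ D}, ∑ ab : Fin r × Fin r, Y M ab.2 ab.1 *
          ((∑ j ∈ range (2 * c' + 1 + 1), ((2 * c' + 1 - j).factorial : ℝ) • (if D < j then 0 else p ab j)) A.1 *
            knapsackMoment M.1.card (((2 * c' + 1 : ℕ) : ℝ) / 2) (M.1.filter fun e => ∃ a ∈ A.1, a ∈ e).card) :=
          Fintype.sum_congr _ _ fun M => Fintype.sum_congr _ _ fun A => h1 M A
      _ = ∑ M : PMatch n, ∑ ab : Fin r × Fin r, ∑ A : {A : Finset (Fin n) // A.card ≤ D}, Y M ab.2 ab.1 *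
          ((∑ j ∈ range (2 * c' + 1 + 1), ((2 * c' + 1 - j).factorial : ℝ) • (if D < j then 0 else p ab j)) A.1 *
            knapsackMoment M.1.card (((2 * c' + 1 : ℕ) : ℝ) / 2) (M.1.filter fun e => ∃ a ∈ A.1, a ∈ e).card) :=
          Fintype.sum_congr _ _ fun M => Finset.sum_comm
      _ = ∑ ab : Fin r × Fin r, ∑ M : PMatch n, ∑ A : {A : Finset (Fin n) // A.card ≤ D}, Y M ab.2 ab.1 *
          ((∑ j ∈ range (2 * c' + 1 + 1), ((2 * c' + 1 - j).factorial : ℝ) • (if D < j then 0 else p ab j)) A.1 *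
            knapsackMoment M.1.card (((2 * c' + 1 : ℕ) : ℝ) / 2) (M.1.filter fun e => ∃ a ∈ A.1, a ∈ e).card) := Finset.sum_comm
      _ = _ := Fintype.sum_congr _ _ fun ab => Fintype.sum_congr _ _ fun M => by rw [mul_sum]
  rw [hexp, sum_mul]
  rw [sum_congr rfl fun ab _ => virtual_weighted_mul_eq hn ht hD (p ab) (hp ab) (fun M => Y M ab.2 ab.1)]
  rw [sum_comm]
  exact sum_congr rfl fun κ _ => by rw [mul_sum]

/-- **The constant mode of a weighted rectangle**: `T_0(p, y) = t!·p_0(∅)·N₁·Σ_M y(M)` (`t = 2c'+1`), i.e. the `κ = 0` term of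
`virtual_weighted_mul_eq` / `virtual_psd_mul_eq` is the slice mean of the test function times the total weight — for a psd strategy, summed
over the entry pairs, `N₁·|PM|·tr(X̄ Ȳ)` (the overlap of brick 36). [cite: Rothvoss2017, §2 (PDF p. 6)] [cite: BrouwerHaemers2012, Prop. 4.3.2 (PDF p. 83)] -/
theorem layerCorr_zero_weighted {c' : ℕ} {p₀ : Finset (Fin n) → ℝ} (hp : IsHarmonic 0 p₀) (y : PMatch n → ℝ) :
    ∑ M : PMatch n, y M * ∑ U ∈ univ.powersetCard (2 * c' + 1),
        (up^[2 * c' + 1 - 2 * 0] p₀) U * (if (U.filter fun x => M.2.partner x ∉ U).card = 1 then (1 : ℝ) else 0) =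
      ((2 * c' + 1).factorial : ℝ) * p₀ ∅ * ((((n / 2).choose (1 + c') * (1 + c').choose c' * 2 ^ 1 : ℕ) : ℝ)) *
        ∑ M : PMatch n, y M := by
  have hcol : ∀ M : PMatch n, ∑ U ∈ univ.powersetCard (2 * c' + 1),
      (if (U.filter fun x => M.2.partner x ∉ U).card = 1 then (1 : ℝ) else 0) =
      (((n / 2).choose (1 + c') * (1 + c').choose c' * 2 ^ 1 : ℕ) : ℝ) :=
    fun M => Summit.PneNP.PneNP.Theorems.ChebyshevTracialDesignLevelAttenuation.level_colSum_eq (r := 1) (e := c') ⟨0, rfl⟩ (by omega) M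
  rw [mul_sum]
  refine sum_congr rfl fun M _ => ?_
  have h1 : ∑ U ∈ univ.powersetCard (2 * c' + 1),
      (up^[2 * c' + 1 - 2 * 0] p₀) U * (if (U.filter fun x => M.2.partner x ∉ U).card = 1 then (1 : ℝ) else 0) =
      ((2 * c' + 1).factorial : ℝ) * p₀ ∅ * ∑ U ∈ univ.powersetCard (2 * c' + 1),
        (if (U.filter fun x => M.2.partner x ∉ U).card = 1 then (1 : ℝ) else 0) := by
    rw [mul_sum]
    refine sum_congr rfl fun U hU => ?_
    rw [Nat.mul_zero, Nat.sub_zero, iterate_up_apply_of_degree_zero hp.1 (mem_powersetCard.1 hU).2]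
  rw [h1, hcol M]
  ring

end Summit.PneNP.PneNP.Theorems.ChebyshevTracialDesignVirtualBimodePsd
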